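import Summits.BirchSwinnertonDyer.BirchSwinnertonDyer.Theorems.AdditiveKolyvaginRoadKolyvaginTransverseIsotropy
import Summits.BirchSwinnertonDyer.BirchSwinnertonDyer.Theorems.KolyvaginRoadThreeMethod2KolyvaginPerfLocal
import HarnessLib

/-!
# Route `AdditiveKolyvaginRoad`, crux `KolyvaginPrimitiveAdditive` (item stmt-BirchSwinnertonDyer-20132):
# stub LOC, input (Perf) at a general odd prime `p` — the LOCAL LEMMAS at a Kolyvagin prime (first layer of the port
# of zhang3-p1's (Perf))
# (cell `pub/bsd-wall`, lead prover `bsd-wall-akr-p1` g3; `--supports stmt-BirchSwinnertonDyer-20132`, helper;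
# p-generic port of zhang3-p1's `Theorems/KolyvaginRoadThreeMethod2KolyvaginPerfLocal.lean`)

WHY THIS FILE. Stub LOC of skeleton v7.1/v8 of crux 20132 is reduced to (Perf) + (Supply)
(`kolyvaginLocalPackageP_of_perf_of_supply`). (Perf) at `p = 3` (zhang3-p1 `…Method2KolyvaginPerf`, `…CupNonvanishing`)
rests on four local lemmas at a Kolyvagin prime with the prime `3` hard-coded; this file is their general-`p` port
(level `p¹`), over bsd-jet's general-`p` decomposition-trivial lemmas and this seat's `…KolyvaginTransverseIsotropy` §1.

WHAT. `K` imaginary quadratic, `ℓ` a Kolyvagin prime of W. Zhang at `p`, `λ ∋ ℓ`: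
* `smul_eq_self_of_pow_eq_one_of_mem_torsionFixing_P` — `Γ_{K(E[p])}` fixes `μ_p`, granted a `Γ_K`-equivariant
  right-non-degenerate `μ_p`-valued pairing on `E[p]` (some value is a primitive `p`-th root of unity);
* `exists_forall_apply_eq_nsmul_of_mem_transverseLocalKerP` — a TRANSVERSE class is rank one on `Γ_{K_λ}`: its cocycle
  satisfies `φ(res s) ∈ ℕ · φ(res σ₀)` (restriction to `K[ℓ]` lands in the cyclic `Gal(K[ℓ]/K[1])`, `G_𝔓` fixes `E[p]`);
* `exists_inertia_inv_mul_mem_ringClassStabilizer_P` — `G_𝔓 = I_𝔓 · (G_𝔓 ∩ Stab K[ℓ])` (`λ` splits completely in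
  `K[1]`, totally ramified in `K[ℓ]/K[1]`);
* `weil_ne_one_of_eigen_P` — opposite eigenvectors of an additive map on `E[p] ≅ (ℤ/p)²` pair non-trivially under an
  alternating right-non-degenerate pairing (`p` odd).
Proofs = zhang3-p1's with `3 ↦ p¹` (primitive-root step via `orderOf`).

HONEST FRAMING: theorems only; 0 definitions, 0 named facts, 0 `sorry`; closes nothing.

References: [cite: GrossLMS1991, §3 (p. 218), Prop. 8.1 (1)–(2)] [cite: WZhang2014, §8.1 (H¹_tr)] [cite: SilvermanAEC2009,
III.8.1] [cite: Cox2013, §9.A].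
-/

-- single-conjunct summit: `Summit.BirchSwinnertonDyer.BirchSwinnertonDyer.…` repeats the name by design
set_option linter.dupNamespace false

noncomputable section

open scoped Classical Pointwise

namespace Summit.BirchSwinnertonDyer.BirchSwinnertonDyer.Theorems.AdditiveKoly

open CategoryTheory WeierstrassCurve Field Function NumberField IsDedekindDomain
open Literature.NumberTheory.EllipticCurves Literature.NumberTheory.EllipticCurves.ModularForms
  Literature.NumberTheory.GaloisRepresentations Module
open Literature.NumberTheory.GaloisCohomology
open Summit.BirchSwinnertonDyer.Rank1Residual.X11b.Three.Koly.Method2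
open Summit.BirchSwinnertonDyer.Rank1Residual.GaloisImage
open Summit.BirchSwinnertonDyer.Rank1Residual.JET Summit.BirchSwinnertonDyer.Rank1Residual.X11b
open scoped ContRepresentation

variable (W : WeierstrassCurve ℚ) (K : Type) [Field K] [NumberField K] (p : ℕ) [W.IsElliptic] [W.IsGloballyMinimal]
  [Fact p.Prime]

omit [W.IsGloballyMinimal] in
/-- **`Γ_{K(E[p])}` fixes `μ_p`**, granted a `Γ_K`-equivariant `μ_p`-valued pairing `e` on `E[p]`, non-degenerate on the
right: the values `e(P, Q)` are fixed by `Γ_{K(E[p])}` and some `e(P, Q) ≠ 1` is a primitive `p`-th root of unity, of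
which every `ζ` with `ζ^p = 1` is a power. [cite: SilvermanAEC2009, III.8.1] -/
theorem smul_eq_self_of_pow_eq_one_of_mem_torsionFixing_P
    (e : geomTorsion (W.baseChange K) ((p ^ 1 : ℕ) : ℤ) → geomTorsion (W.baseChange K) ((p ^ 1 : ℕ) : ℤ) →
      AlgebraicClosure K)
    (hμ : ∀ P Q, e P Q ^ (p ^ 1) = 1) (hnondeg : ∀ Q, (∀ P, e P Q = 1) → Q = 0)
    (hgal : ∀ (σ : absoluteGaloisGroup K) (P Q : geomTorsion (W.baseChange K) ((p ^ 1 : ℕ) : ℤ)),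
      σ • e P Q = e (σ • P) (σ • Q))
    {d : absoluteGaloisGroup K} (hd : d ∈ torsionFixing (W.baseChange K) ((p ^ 1 : ℕ) : ℤ))
    {ζ : AlgebraicClosure K} (hζ : ζ ^ p = 1) : d • ζ = ζ := by
  have hp : p.Prime := Fact.out
  -- a non-zero `Q` and a `P` with `e P Q ≠ 1`
  have hcard : Nat.card (geomTorsion (W.baseChange K) ((p ^ 1 : ℕ) : ℤ)) = (p ^ 1) ^ 2 :=
    card_torsionPoints_eq_sq_holds (W.baseChange K) (AlgebraicClosure K) (n := p ^ 1)
      (by exact_mod_cast pow_ne_zero 1 hp.ne_zero)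
  haveI : Finite (geomTorsion (W.baseChange K) ((p ^ 1 : ℕ) : ℤ)) :=
    Nat.finite_of_card_ne_zero (by rw [hcard]; exact pow_ne_zero 2 (pow_ne_zero 1 hp.ne_zero))
  obtain ⟨Q, hQ⟩ : ∃ Q : geomTorsion (W.baseChange K) ((p ^ 1 : ℕ) : ℤ), Q ≠ 0 := by
    by_contra h
    push Not at h
    have h1 : Nat.card (geomTorsion (W.baseChange K) ((p ^ 1 : ℕ) : ℤ)) = 1 :=
      Nat.card_eq_one_iff_exists.mpr ⟨0, fun R ↦ h R⟩
    rw [hcard, pow_one] at h1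
    exact hp.one_lt.ne' (by nlinarith [hp.one_lt, h1])
  obtain ⟨P, hP⟩ : ∃ P, e P Q ≠ 1 := by
    by_contra h
    push Not at h
    exact hQ (hnondeg Q h)
  -- `e P Q` is a primitive `p`-th root of unity, fixed by `d`
  have hpow : e P Q ^ p = 1 := by simpa using hμ P Q
  have hord : orderOf (e P Q) = p :=
    ((Nat.dvd_prime hp).mp (orderOf_dvd_of_pow_eq_one hpow)).resolve_left
      (fun h1 ↦ hP (orderOf_eq_one_iff.mp h1))
  have hprim : IsPrimitiveRoot (e P Q) p := hord ▸ IsPrimitiveRoot.orderOf (e P Q)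
  have hfix : d • e P Q = e P Q := by
    rw [hgal, smul_eq_of_mem_torsionFixing (W.baseChange K) _ hd, smul_eq_of_mem_torsionFixing (W.baseChange K) _ hd]
  obtain ⟨k, -, rfl⟩ := hprim.eq_pow_of_pow_eq_one hζ
  rw [smul_pow', hfix]

/-- **A transverse class is rank one on `Γ_{K_λ}`** at a Kolyvagin prime of W. Zhang at `p`: for
`y ∈ transverseLocalKerP W K p ι ℓ v` with cocycle `φ`, there is `σ₀ ∈ Γ_{K_λ}` such that `φ (res s) ∈ ℕ · φ (res σ₀)` for
every `s ∈ Γ_{K_λ}`. [cite: WZhang2014, §8.1 (H¹_tr)] [cite: GrossLMS1991, §3–§4] -/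
theorem exists_forall_apply_eq_nsmul_of_mem_transverseLocalKerP (hK : IsImaginaryQuadratic K) (ι : K →+* ℂ) {ℓ : ℕ}
    (hℓ : Zhang2014.IsKolyvaginPrime (W.conductorNorm ℤ) W K p ℓ) (v : HeightOneSpectrum (𝓞 K))
    (hv : (ℓ : 𝓞 K) ∈ v.asIdeal) {𝔐 : Ideal (HeightOneSpectrum.localAbsIntegers v)} (h𝔐 : 𝔐 ∈ v.localPrimesAbove)
    {y : Vp W K p} (hy : y ∈ transverseLocalKerP W K p ι ℓ v)
    (φ : contOneCocycles (discreteTopRep (absoluteGaloisGroup K) (geomTorsion (W.baseChange K) ((p ^ 1 : ℕ) : ℤ))))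
    (hφ : oneCocycleClass _ φ = y) :
    ∃ σ₀ : absoluteGaloisGroup (v.adicCompletion K), ∀ s : absoluteGaloisGroup (v.adicCompletion K), ∃ i : ℕ,
      φ.1 (absGaloisRestrict K (v.adicCompletion K) s) = i • φ.1 (absGaloisRestrict K (v.adicCompletion K) σ₀) := by
  have hp : p.Prime := Fact.out
  haveI : NeZero (p ^ 1 : ℕ) := ⟨pow_ne_zero 1 hp.ne_zero⟩
  have hℓp : ℓ.Prime := hℓ.1
  have hℓ0 : ℓ ≠ 0 := hℓp.ne_zero
  have hℓP : (Ideal.span {(ℓ : 𝓞 K)}).IsPrime := hℓ.2.2.2.2.1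
  have hk1 : 1 ≤ Zhang2014.kolyvaginIndex W p ℓ := hℓ.2.2.2.2.2
  haveI := (finiteDimensional_and_isGalois_ringClassField hK ι hℓ0).1
  haveI := (finiteDimensional_and_isGalois_ringClassField hK ι hℓ0).2
  haveI := (finiteDimensional_and_isGalois_ringClassField hK ι one_ne_zero).1
  haveI : FiniteDimensional ℚ (ringClassField K ι ℓ) := Module.Finite.trans K (ringClassField K ι ℓ)
  set Kv := v.adicCompletion K with hKv
  set ι₀ := closureEmb (K := K) Kv with hι₀
  set 𝔓 := v.primeBelow ι₀ 𝔐 with h𝔓def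
  have h𝔓 : 𝔓 ∈ v.primesAbove := HeightOneSpectrum.primeBelow_mem_primesAbove h𝔐
  have hres : ∀ s : absoluteGaloisGroup Kv,
      absGaloisRestrict K Kv s ∈ 𝔓.decompositionSubgroup (absoluteGaloisGroup K) := fun s ↦ by
    rw [← resGal_eq_absGaloisRestrict, resGal_eq]
    exact resGalOfEmb_mem_decompositionSubgroup ι₀ h𝔐 s
  have hfix : ∀ (s : absoluteGaloisGroup Kv) (Q : geomTorsion (W.baseChange K) ((p ^ 1 : ℕ) : ℤ)),
      absGaloisRestrict K Kv s • Q = Q := fun s Q ↦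
    GlobalDuality.smul_torsion_eq_self_of_mem_decompositionSubgroup W K hK hℓ hk1 v hv h𝔓 (hres s) Q
  have htf : ∀ s : absoluteGaloisGroup Kv,
      absGaloisRestrict K Kv s ∈ torsionFixing (W.baseChange K) ((p ^ 1 : ℕ) : ℤ) := fun s ↦
    GlobalDuality.decompositionSubgroup_le_torsionFixing W K hK hℓ hk1 v hv h𝔓 (hres s)
  -- the restriction `χ : Γ_{K_v} → Gal(K[ℓ]/K)` along a `K`-embedding `e₀ : K[ℓ] → K̄`
  let e₀ : ringClassField K ι ℓ →ₐ[K] AlgebraicClosure K := IsAlgClosed.lift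
  obtain ⟨π, hπ⟩ := KolyvaginH44.exists_absGaloisRestrict hK ι ℓ e₀
  let χ : absoluteGaloisGroup Kv →* ringClassGal ι ℓ := π.comp (absGaloisRestrict K Kv).toMonoidHom
  have hχ : ∀ s, χ s = π (absGaloisRestrict K Kv s) := fun _ ↦ rfl
  have hker : ∀ s, χ s = 1 → absGaloisRestrict K Kv s ∈ ringClassStabilizer K ι ℓ ℓ := by
    intro s hs
    refine KolyLocal.mem_ringClassStabilizer_of_forall_smul_eq K hK ι hℓ0 e₀ fun z ↦ ?_
    rw [hπ, ← hχ, hs, OneMemClass.coe_one, AlgEquiv.one_apply]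
  -- the image of `χ` lies in the cyclic `Gal(K[ℓ]/K[1])`
  have h1ℓ : ringClassField K ι 1 ≤ ringClassField K ι ℓ := ringClassField_mono hK ι (one_dvd ℓ) hℓ0
  have himg : ∀ s, ((χ s : ringClassGal ι ℓ) : ringClassField K ι ℓ ≃ₐ[ℚ] ringClassField K ι ℓ) ∈
      ringClassGalOver ι ℓ 1 := by
    intro s
    rw [ringClassGalOver, mem_fixingSubgroup_iff]
    intro z hz
    rw [AlgEquiv.smul_def]
    obtain ⟨z₁, hz₁⟩ : ∃ z₁ : ringClassField K ι 1, RingClassField.inclusion ι h1ℓ z₁ = z :=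
      ⟨⟨(z : ℂ), hz⟩, Subtype.ext (RingClassField.coe_inclusion ι h1ℓ _)⟩
    have key : e₀ (((χ s : ringClassGal ι ℓ) : ringClassField K ι ℓ ≃ₐ[ℚ] ringClassField K ι ℓ) z) = e₀ z := by
      rw [hχ, ← hπ, ← hz₁]
      exact smul_ringClassFieldOne_eq_self_of_mem_decompositionSubgroup_P W K p hK ι hℓ v hv h𝔓
        (e₀.comp (RingClassField.inclusion ι h1ℓ)) (hres s) z₁
    exact e₀.injective key
  have hcycG : IsCyclic (ringClassGalOver ι ℓ 1) := by
    have h := RingClassGalOverCyclic.isCyclic_ringClassGalOver hK ι (ℓ := ℓ) (m' := 1) one_ne_zero hℓp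
      (fun h ↦ hℓp.one_lt.ne' (Nat.dvd_one.mp h)) hℓP
    rwa [Nat.mul_one] at h
  have hcyc : ∃ σ : absoluteGaloisGroup Kv, ∀ s, ∃ i : ℕ, χ s = χ σ ^ i := by
    let ψ : absoluteGaloisGroup Kv →* ringClassGalOver ι ℓ 1 :=
      ((ringClassGal ι ℓ).subtype.comp χ).codRestrict (ringClassGalOver ι ℓ 1) (fun s ↦ himg s)
    have hψ : ∀ s, ((ψ s : ringClassGalOver ι ℓ 1) : ringClassField K ι ℓ ≃ₐ[ℚ] ringClassField K ι ℓ) =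
        (χ s : ringClassField K ι ℓ ≃ₐ[ℚ] ringClassField K ι ℓ) := fun _ ↦ rfl
    haveI : IsCyclic ψ.range := isCyclic_of_injective ψ.range.subtype ψ.range.subtype_injective
    obtain ⟨g₀, hg₀⟩ := IsCyclic.exists_monoid_generator (α := ψ.range)
    obtain ⟨σ, hσ⟩ := MonoidHom.mem_range.mp g₀.2
    refine ⟨σ, fun s ↦ ?_⟩
    obtain ⟨i, hi⟩ := (Submonoid.mem_powers_iff _ _).mp (hg₀ ⟨ψ s, ⟨s, rfl⟩⟩)
    refine ⟨i, Subtype.ext ?_⟩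
    have h1 : ((g₀ ^ i : ψ.range) : ringClassGalOver ι ℓ 1) = ψ s := congrArg Subtype.val hi
    rw [SubmonoidClass.coe_pow, ← hσ] at h1
    have h2 := congrArg (fun t : ringClassGalOver ι ℓ 1 ↦ (t : ringClassField K ι ℓ ≃ₐ[ℚ] ringClassField K ι ℓ))
      h1
    simp only [SubmonoidClass.coe_pow, hψ] at h2
    rw [SubmonoidClass.coe_pow]
    exact h2.symm
  obtain ⟨σ₀, hσ₀⟩ := hcyc
  -- `φ ∘ res` is additive and kills `ker χ`
  have hadd : ∀ s t : absoluteGaloisGroup Kv, φ.1 (absGaloisRestrict K Kv (s * t)) =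
      φ.1 (absGaloisRestrict K Kv s) + φ.1 (absGaloisRestrict K Kv t) := fun s t ↦ by
    rw [map_mul, φ.2]
    change _ + absGaloisRestrict K Kv s • φ.1 (absGaloisRestrict K Kv t) = _
    rw [hfix]
  have hone : φ.1 (absGaloisRestrict K Kv 1) = 0 := by
    have h := hadd 1 1
    rw [mul_one] at h
    exact left_eq_add.mp h
  have hpow : ∀ (s : absoluteGaloisGroup Kv) (m : ℕ), φ.1 (absGaloisRestrict K Kv (s ^ m)) =
      m • φ.1 (absGaloisRestrict K Kv s) := fun s m ↦ by
    induction m with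
    | zero => rw [pow_zero, hone, zero_smul]
    | succ m ih => rw [pow_succ s m, hadd, ih, succ_nsmul]
  have hvan : ∀ s, χ s = 1 → φ.1 (absGaloisRestrict K Kv s) = 0 := fun s hs ↦ by
    have h := (mem_transverseLocalKerP_iff.mp hy) 𝔓 h𝔓 _ (hres s) (hker s hs) (htf s)
    rwa [← hφ, h1Eval_oneCocycleClass _ _ φ (htf s)] at h
  refine ⟨σ₀, fun s ↦ ?_⟩
  obtain ⟨i, hi⟩ := hσ₀ s
  refine ⟨i, ?_⟩
  have hs : s = (s * (σ₀ ^ i)⁻¹) * σ₀ ^ i := by rw [inv_mul_cancel_right]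
  have hk : χ (s * (σ₀ ^ i)⁻¹) = 1 := by rw [map_mul, map_inv, map_pow, hi, mul_inv_cancel]
  rw [hs, hadd, hvan _ hk, zero_add, hpow]

omit [W.IsElliptic] [Fact p.Prime] in
/-- **`G_𝔓 = I_𝔓 · (G_𝔓 ∩ Stab K[ℓ])` at a Kolyvagin prime** (any `p`): every `d ∈ G_𝔓` is `i · d'` with `i ∈ I_𝔓`
and `d'` in the stabiliser of `K[ℓ]`. [cite: GrossLMS1991, §3 (p. 218 l. 1)] [cite: Cox2013, §9.A] -/
theorem exists_inertia_inv_mul_mem_ringClassStabilizer_P (hK : IsImaginaryQuadratic K) (ι : K →+* ℂ) {ℓ : ℕ}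
    (hℓ : Zhang2014.IsKolyvaginPrime (W.conductorNorm ℤ) W K p ℓ) (v : HeightOneSpectrum (𝓞 K))
    (hv : (ℓ : 𝓞 K) ∈ v.asIdeal) (hv₀ : ∀ v' : HeightOneSpectrum (𝓞 K), ((ℓ : ℕ) : 𝓞 K) ∈ v'.asIdeal ↔ v' = v)
    {𝔓 : Ideal (absIntegers (𝓞 K) K)} (h𝔓 : 𝔓 ∈ v.primesAbove) {d : absoluteGaloisGroup K}
    (hd : d ∈ 𝔓.decompositionSubgroup (absoluteGaloisGroup K)) :
    ∃ i ∈ 𝔓.inertia (absoluteGaloisGroup K), i⁻¹ * d ∈ ringClassStabilizer K ι ℓ ℓ := by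
  have hℓp : ℓ.Prime := hℓ.1
  have hℓ0 : ℓ ≠ 0 := hℓp.ne_zero
  haveI := (finiteDimensional_and_isGalois_ringClassField hK ι hℓ0).1
  haveI := (finiteDimensional_and_isGalois_ringClassField hK ι hℓ0).2
  haveI := (finiteDimensional_and_isGalois_ringClassField hK ι one_ne_zero).1
  let e₀ : ringClassField K ι ℓ →ₐ[K] AlgebraicClosure K := IsAlgClosed.lift
  obtain ⟨π, hπ⟩ := KolyvaginH44.exists_absGaloisRestrict hK ι ℓ e₀
  have h1ℓ : ringClassField K ι 1 ≤ ringClassField K ι ℓ := ringClassField_mono hK ι (one_dvd ℓ) hℓ0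
  have himg : ((π d : ringClassGal ι ℓ) : ringClassField K ι ℓ ≃ₐ[ℚ] ringClassField K ι ℓ) ∈
      ringClassGalOver ι ℓ (ℓ / ℓ) := by
    rw [Nat.div_self hℓp.pos, ringClassGalOver, mem_fixingSubgroup_iff]
    intro z hz
    rw [AlgEquiv.smul_def]
    obtain ⟨z₁, hz₁⟩ : ∃ z₁ : ringClassField K ι 1, RingClassField.inclusion ι h1ℓ z₁ = z :=
      ⟨⟨(z : ℂ), hz⟩, Subtype.ext (RingClassField.coe_inclusion ι h1ℓ _)⟩
    have key : e₀ (((π d : ringClassGal ι ℓ) : ringClassField K ι ℓ ≃ₐ[ℚ] ringClassField K ι ℓ) z) = e₀ z := by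
      rw [← hπ, ← hz₁]
      exact smul_ringClassFieldOne_eq_self_of_mem_decompositionSubgroup_P W K p hK ι hℓ v hv h𝔓
        (e₀.comp (RingClassField.inclusion ι h1ℓ)) hd z₁
    exact e₀.injective key
  obtain ⟨τ, hτI, hτ⟩ := RingClassTower.exists_mem_inertia_smul_eq_of_mem_ringClassGalOver hK ι hℓ0 hℓp (dvd_refl ℓ)
    (fun h ↦ hℓp.one_lt.ne' (Nat.dvd_one.mp (by rwa [Nat.div_self hℓp.pos] at h))) hv₀ h𝔓 e₀ himg
  refine ⟨τ, hτI, KolyLocal.mem_ringClassStabilizer_of_forall_smul_eq K hK ι hℓ0 e₀ fun z ↦ ?_⟩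
  rw [mul_smul, hπ, ← hτ z, inv_smul_smul]

omit [W.IsGloballyMinimal] in
/-- **Opposite eigenvectors pair non-trivially** (`p` odd): for a bi-additive alternating right-non-degenerate
`μ_p`-valued pairing `e` on `E[p] ≅ (ℤ/p)²`, an additive `ι` and `ν = ±1`, if `P ≠ 0`, `ι P = ν P`, `Q ≠ 0`,
`ι Q = -ν Q`, then `e(P, Q) ≠ 1`. [cite: GrossLMS1991, Prop. 8.1 (2) (proof)] -/
theorem weil_ne_one_of_eigen_P (hp2 : p ≠ 2)
    (e : geomTorsion (W.baseChange K) ((p ^ 1 : ℕ) : ℤ) → geomTorsion (W.baseChange K) ((p ^ 1 : ℕ) : ℤ) →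
      AlgebraicClosure K)
    (hμ : ∀ P Q, e P Q ^ (p ^ 1) = 1) (hadd₁ : ∀ P₁ P₂ Q, e (P₁ + P₂) Q = e P₁ Q * e P₂ Q)
    (hadd₂ : ∀ P Q₁ Q₂, e P (Q₁ + Q₂) = e P Q₁ * e P Q₂) (halt : ∀ Q, e Q Q = 1)
    (hnondeg : ∀ Q, (∀ P, e P Q = 1) → Q = 0)
    (ιT : geomTorsion (W.baseChange K) ((p ^ 1 : ℕ) : ℤ) →+ geomTorsion (W.baseChange K) ((p ^ 1 : ℕ) : ℤ))
    {ν : ℤ} (hν : ν = 1 ∨ ν = -1) {P Q : geomTorsion (W.baseChange K) ((p ^ 1 : ℕ) : ℤ)}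
    (hP : ιT P = ν • P) (hP0 : P ≠ 0) (hQ : ιT Q = -(ν • Q)) (hQ0 : Q ≠ 0) : e P Q ≠ 1 := by
  intro hPQ
  have hp : p.Prime := Fact.out
  haveI hp1 : Fact (Nat.Prime (p ^ 1)) := ⟨by rw [pow_one]; exact hp⟩
  have hne : ∀ a b, e a b ≠ 0 := fun a b h0 ↦ by
    have h := hμ a b
    rw [h0, zero_pow (pow_ne_zero 1 hp.ne_zero)] at h
    exact zero_ne_one h
  -- the additive flipped pairing `E a b = e(b, a)` with values in `Additive K̄ˣ`
  have hmk₁ : ∀ a a' b, Units.mk0 (e (a + a') b) (hne _ _) = Units.mk0 (e a b) (hne _ _) * Units.mk0 (e a' b) (hne _ _) :=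
    fun a a' b ↦ Units.ext (by rw [Units.val_mk0, Units.val_mul, Units.val_mk0, Units.val_mk0, hadd₁])
  have hmk₂ : ∀ a b b', Units.mk0 (e a (b + b')) (hne _ _) = Units.mk0 (e a b) (hne _ _) * Units.mk0 (e a b') (hne _ _) :=
    fun a b b' ↦ Units.ext (by rw [Units.val_mk0, Units.val_mul, Units.val_mk0, Units.val_mk0, hadd₂])
  let E : geomTorsion (W.baseChange K) ((p ^ 1 : ℕ) : ℤ) →+ geomTorsion (W.baseChange K) ((p ^ 1 : ℕ) : ℤ) →+
      Additive (AlgebraicClosure K)ˣ :=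
    AddMonoidHom.mk' (fun a ↦ AddMonoidHom.mk' (fun b ↦ Additive.ofMul (Units.mk0 (e b a) (hne b a)))
      (fun b b' ↦ by rw [← ofMul_mul, ← hmk₁]))
      (fun a a' ↦ by ext b; simp only [AddMonoidHom.mk'_apply, AddMonoidHom.add_apply]; rw [← ofMul_mul, ← hmk₂])
  have hE0 : ∀ a b, E a b = 0 ↔ e b a = 1 := fun a b ↦ by
    change Additive.ofMul (Units.mk0 (e b a) (hne b a)) = 0 ↔ _
    rw [ofMul_eq_zero, Units.ext_iff, Units.val_mk0, Units.val_one]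
  -- `E[p] ≅ (ℤ/p)²`
  have hcard : Nat.card (geomTorsion (W.baseChange K) ((p ^ 1 : ℕ) : ℤ)) = (p ^ 1) ^ 2 :=
    card_torsionPoints_eq_sq_holds (W.baseChange K) (AlgebraicClosure K) (n := p ^ 1)
      (by exact_mod_cast pow_ne_zero 1 hp.ne_zero)
  have hpT : ∀ R : geomTorsion (W.baseChange K) ((p ^ 1 : ℕ) : ℤ), (p ^ 1) • R = 0 := fun R ↦ by
    have := (mem_geomTorsion_iff (W.baseChange K) ((p ^ 1 : ℕ) : ℤ) _).mp R.2
    apply Subtype.ext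
    rw [AddSubgroupClass.coe_nsmul, ← natCast_zsmul]
    exact this
  have halt' : ∀ a, E a a = 0 := fun a ↦ (hE0 a a).mpr (halt a)
  have hnd' : ∀ a, (∀ b, E a b = 0) → a = 0 := fun a h ↦ hnondeg a fun b ↦ (hE0 a b).mp (h b)
  have hmem : Q ∈ AddSubgroup.zmultiples P :=
    KolyvaginReciprocity.mem_zmultiples_of_pairing_eq_zero hcard hpT E halt' hnd' hP0 ((hE0 Q P).mpr hPQ)
  have hν' : -ν = 1 ∨ -ν = -1 := by rcases hν with rfl | rfl <;> simp
  have hP' : ιT P = -((-ν) • P) := by rw [neg_smul, neg_neg]; exact hP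
  have hQ' : ιT Q = (-ν) • Q := by rw [neg_smul]; exact hQ
  exact hQ0 (KolyvaginReciprocity.eq_zero_of_eigen_of_mem_zmultiples hp1.out (by rw [pow_one]; exact hp2) hpT ιT hν'
    hP' hQ' hmem)

end Summit.BirchSwinnertonDyer.BirchSwinnertonDyer.Theorems.AdditiveKoly

end
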